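import Literature.NumberTheory.LFunctions.SuzukiScrewTestFunction
import Literature.NumberTheory.LFunctions.WeilExplicitBombieriLipschitz
import Literature.NumberTheory.LFunctions.FordZetaZeroRecipSqSum
import HarnessLib

/-!
# The explicit-formula half of CJM Prop 3.1 for the test function `g_{z;t,t'}` — assembly

LINE 1 — LABEL: RH-FREE proofs (proof-only module: no definition, no named fact).  bears_on:
LADDER-RH B-C/B-P (COLUMN 6 DBR).  WHAT THIS IS NOT: no fact is discharged here; the module reduces
the explicit-formula half of CJM Prop 3.1 (`Suzuki2025_prop31`, RH-FREE) to ONE remaining closed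
form (the Bombieri archimedean term of `g_{z;t,t'}`, hypothesis `hArch` below); nothing here bears on
the truth of RH.

SOURCE. M. Suzuki, Canad. J. Math. (2025) = arXiv:2301.00421v3 [`Suzuki2025WeilHilbertSpace`],
proof of Prop 3.1 (TeX l.789–980): Weil's explicit formula (3.3) [Bombieri 2000, p.186] applied to
`φ_{z,t}`; here applied (tree: `explicit_formula_continuous_bombieri`, (3.3) for continuous compactly
supported Lipschitz test functions) to the compact combination
`g_{z;t,t'} = c_tφ_{z,t} − c_{t'}φ_{z,t'}` of `SuzukiScrewTestFunction.lean`.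

## What is proved (`Im z > 1`, `t, t' > 0`; `γ = suzukiZeroParam ρ`, `c_t = suzukiPhiCoeff z t`)

* `ScrewExplicitHalf.zeroParam_ne_zero`, `zeroParam_ne`, `inv_norm_mul_le`
  (`1/(‖γ‖‖z − γ‖) ≤ 4(‖z‖+1)/(1 + (Im ρ)²)`, from `|Im ρ| > 14`, `FordL33.fourteen_lt_abs_im`);
* `summable_norm_zeroSide` — the zero side of (3.3) for `g` converges absolutely (input `hZ`), and
  `summable_screwTerm` — so does `P_t(z)` (CJM TeX l.776–781), via
  `ZetaZeroSum.summable_zeroOrder_div_one_add_sq`;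
* `tsum_zeroSide_eq` — **`Σ_ρ m(ρ)ĝ(ρ) = c_t P_t(z) − c_{t'} P_{t'}(z)`** (TeX l.827–830);
* `exists_norm_weilMellin_half_le`, `integrable_weilMellin_mul_re_digamma` — the archimedean
  integrability input `hA` of the tree's (3.3) for `g` (`‖ĝ(½+iy)‖ = O((1+y²)⁻¹)` against
  `‖ψ(¼ + iy/2)‖ ≤ C + log(1+|y|)`, `Literature.Analysis.SpecialFunctions.Complex`);
* `coeff_mul_sub_eq_of_arch` — **assembly**: IF `weilArchTermBombieri g = c_t·T(t) − c_{t'}·T(t')`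
  with `T(τ) = −(1/2iz)[ψ(¼ − iz/2) − ψ(¼)] − (1/2iz)e^{−τ/2}·screwLerchBracket τ z` (terms 5–6 of
  `screwP`; the printed computation TeX l.866–975), THEN
  `c_t(𝔓_t(z) − P_t(z)) = c_{t'}(𝔓_{t'}(z) − P_{t'}(z))` for `0 < t ≤ t'` — with
  `weilPolarTerm_suzukiPhiC` (terms 1–2), `weilPrimeTerm_suzukiPhiC_of_le` (term 4; the
  `ζ'/ζ(½ − iz)` terms 3 of `c_t𝔓_t` and `c_{t'}𝔓_{t'}` coincide and cancel).  Together with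
  `Suzuki2025_prop31_of_sub_eq_const_mul` (pinning, `SuzukiScrewLinePinningProofs.lean`) this closes
  Prop 3.1 once `hArch` is proved.

## What remains (not here)

`hArch`: `−∫_0^{t'} e^{x/2}g(x)/(2 sinh x)dx` (`g(0) = 0`, `g(−x) = 0`) `= c_t·T(t) − c_{t'}·T(t')`:
expand `e^{x/2}/(2 sinh x) = Σ_{n≥0} e^{−(2n+½)x}`, integrate termwise (`|g(x)| ≤ Kx` near `0`),
use `∫_a^b e^{−λx}dx`, the digamma series `Σ_n [1/(n+¼) − 1/(n+a)] = ψ(a) − ψ(¼)` (`a = ¼ − iz/2`) and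
`c_t e^{−izt} = 1 + c_t`; the five resulting series regroup into the displayed `T` (TeX l.866–975).

## References

* M. Suzuki, Canad. J. Math. (2025), doi:10.4153/S0008414X25101739 = arXiv:2301.00421v3, Prop. 3.1.
  [Suzuki2025WeilHilbertSpace]
* E. Bombieri, Rend. Lincei (9) 11 (2000) 183–233, Thm 2. [Bombieri2000]
-/

noncomputable section

open MeasureTheory Complex Filter Set
open scoped Topology NNReal

namespace Literature.NumberTheory.LFunctions



namespace ScrewExplicitHalf

open ZetaZeros.riemannZetaNontrivialZeros in
/-- For a non-trivial zero `ρ`, `γ = i(ρ − ½) ≠ 0` (indeed `|Re γ| = |Im ρ| > 14`).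
[cite: Suzuki2025WeilHilbertSpace, §2.2 (TeX l.560–566)] -/
theorem zeroParam_ne_zero (ρ : ZetaZeros.riemannZetaNontrivialZeros) :
    suzukiZeroParam (ρ : ℂ) ≠ 0 := by
  intro h
  have h14 : 14 < |(ρ : ℂ).im| := FordL33.fourteen_lt_abs_im ρ
  have hre : (suzukiZeroParam (ρ : ℂ)).re = -(ρ : ℂ).im := by simp [suzukiZeroParam]
  rw [h, Complex.zero_re] at hre
  have : (ρ : ℂ).im = 0 := by linarith
  rw [this, abs_zero] at h14
  linarith

/-- For `Im z > 1` no `γ ∈ Γ` equals `z` (`Im γ = Re ρ − ½ < ½`).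
[cite: Suzuki2025WeilHilbertSpace, §2.2 (TeX l.560–566)] -/
theorem zeroParam_ne {z : ℂ} (hz : 1 < z.im) (ρ : ZetaZeros.riemannZetaNontrivialZeros) :
    suzukiZeroParam (ρ : ℂ) ≠ z := by
  intro h
  have hre1 := ZetaZeros.riemannZetaNontrivialZeros.re_lt_one ρ.2
  have him : (suzukiZeroParam (ρ : ℂ)).im = (ρ : ℂ).re - 1 / 2 := by simp [suzukiZeroParam]
  rw [h] at him
  linarith

/-- The decay of the summands: for `Im z > 1` and a non-trivial zero `ρ`,
`1/(‖γ‖·‖z − γ‖) ≤ 4(‖z‖ + 1)/(1 + (Im ρ)²)`. [cite: Suzuki2025WeilHilbertSpace, proof of Prop. 3.1 (TeX l.776–781)] -/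
theorem inv_norm_mul_le {z : ℂ} (hz : 1 < z.im) (ρ : ZetaZeros.riemannZetaNontrivialZeros) :
    1 / (‖suzukiZeroParam (ρ : ℂ)‖ * ‖z - suzukiZeroParam (ρ : ℂ)‖) ≤
      4 * (‖z‖ + 1) / (1 + (ρ : ℂ).im ^ 2) := by
  set γ := suzukiZeroParam (ρ : ℂ) with hγdef
  have h14 : 14 < |(ρ : ℂ).im| := FordL33.fourteen_lt_abs_im ρ
  have hre1 := ZetaZeros.riemannZetaNontrivialZeros.re_lt_one ρ.2
  have hγre : γ.re = -(ρ : ℂ).im := by simp [hγdef, suzukiZeroParam]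
  have hγim : γ.im = (ρ : ℂ).re - 1 / 2 := by simp [hγdef, suzukiZeroParam]
  have ha : |(ρ : ℂ).im| ≤ ‖γ‖ := by
    rw [← abs_neg, ← hγre]; exact Complex.abs_re_le_norm γ
  have hd_half : 1 / 2 ≤ ‖z - γ‖ := by
    have h1 := Complex.abs_im_le_norm (z - γ)
    rw [Complex.sub_im, hγim] at h1
    have h2 : 1 / 2 ≤ |z.im - ((ρ : ℂ).re - 1 / 2)| := by
      rw [abs_of_pos (by linarith)]; linarith
    linarith
  have hd_a : ‖γ‖ - ‖z‖ ≤ ‖z - γ‖ := by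
    have := norm_sub_norm_le γ z
    rw [norm_sub_rev] at this
    linarith
  have hz0 : 0 ≤ ‖z‖ := norm_nonneg z
  have hγ0 : 0 ≤ ‖γ‖ := norm_nonneg γ
  -- `‖z − γ‖ ≥ ‖γ‖ / (2(‖z‖ + 1))`
  have hd : ‖γ‖ ≤ 2 * (‖z‖ + 1) * ‖z - γ‖ := by
    rcases le_or_gt ‖γ‖ (‖z‖ + 1) with h | h
    · nlinarith [hd_half]
    · nlinarith [hd_a, h]
  have hγ14 : 14 < ‖γ‖ := h14.trans_le ha
  have hpos : 0 < ‖γ‖ * ‖z - γ‖ := by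
    apply mul_pos (by linarith)
    linarith
  rw [div_le_div_iff₀ hpos (by positivity), one_mul]
  -- `1 + im² ≤ 4(‖z‖+1)·‖γ‖·‖z−γ‖`, using `2(‖z‖+1)‖z−γ‖ ≥ ‖γ‖` and `‖γ‖² ≥ im² > 196`
  have him2 : (ρ : ℂ).im ^ 2 ≤ ‖γ‖ ^ 2 := by
    have := sq_abs ((ρ : ℂ).im)
    nlinarith [ha, abs_nonneg ((ρ : ℂ).im)]
  have h196 : (196 : ℝ) < ‖γ‖ ^ 2 := by nlinarith [hγ14]
  have key : ‖γ‖ * ‖γ‖ ≤ 2 * (‖z‖ + 1) * (‖γ‖ * ‖z - γ‖) := by nlinarith [hd, hγ0]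
  nlinarith [key, him2, h196]

/-- Norm of the `P_t` summand: `‖(e^{−iγt} − 1)/γ · 1/(z − γ)‖ ≤ (e^{t/2} + 1)/(‖γ‖‖z − γ‖)` for
`0 < Re ρ < 1`, `t > 0`. [cite: Suzuki2025WeilHilbertSpace, proof of Prop. 3.1 (TeX l.776–781)] -/
theorem norm_screwTerm_le {z : ℂ} {t : ℝ} (ht : 0 < t) {ρ : ℂ} (hρ1 : ρ.re < 1) :
    ‖(cexp (-(I * suzukiZeroParam ρ * t)) - 1) / suzukiZeroParam ρ * (1 / (z - suzukiZeroParam ρ))‖ ≤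
      (Real.exp (t / 2) + 1) / (‖suzukiZeroParam ρ‖ * ‖z - suzukiZeroParam ρ‖) := by
  have hF : ‖cexp (-(I * suzukiZeroParam ρ * t))‖ ≤ Real.exp (t / 2) := by
    rw [Complex.norm_exp]
    apply Real.exp_le_exp.2
    have : (-(I * suzukiZeroParam ρ * (t : ℂ))).re = (ρ.re - 1 / 2) * t := by
      simp [suzukiZeroParam, Complex.mul_re, Complex.mul_im]; ring
    rw [this]; nlinarith
  rw [div_mul_div_comm, mul_one, norm_div, norm_mul]
  by_cases h0 : ‖suzukiZeroParam ρ‖ * ‖z - suzukiZeroParam ρ‖ = 0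
  · rw [h0, div_zero, div_zero]
  · apply div_le_div_of_nonneg_right _ (by positivity)
    refine (norm_sub_le _ _).trans ?_
    rw [norm_one]; linarith

/-- RH-FREE, PROVED — the zero side of (3.3) for `g_{z;t,t'}` converges absolutely (`Im z > 1`).
[cite: Suzuki2025WeilHilbertSpace, proof of Prop. 3.1 (TeX l.776–781, 827–830)] -/
theorem summable_norm_zeroSide {z : ℂ} (hz : 1 < z.im) {t t' : ℝ} (ht : 0 < t) (ht' : 0 < t') :
    Summable fun ρ : ZetaZeros.riemannZetaNontrivialZeros ↦
      ‖(riemannZetaZeroOrder (ρ : ℂ) : ℂ) * weilMellin (suzukiPhiC z t t') ρ‖ := by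
  have hz0 : z ≠ 0 := by rintro rfl; simp at hz; linarith
  have hzpos : 0 < z.im := zero_lt_one.trans hz
  have h1 := cexp_neg_I_mul_ne_one hzpos ht
  have h2 := cexp_neg_I_mul_ne_one hzpos ht'
  set N : ℝ := ‖suzukiPhiCoeff z t‖ * (Real.exp (t / 2) + 1) +
    ‖suzukiPhiCoeff z t'‖ * (Real.exp (t' / 2) + 1) with hN
  have hN0 : 0 ≤ N := by positivity
  have hS : Summable fun ρ : ZetaZeros.riemannZetaNontrivialZeros ↦
      (riemannZetaZeroOrder (ρ : ℂ) : ℝ) / (1 + (ρ : ℂ).im ^ 2) :=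
    ZetaZeroSum.summable_zeroOrder_div_one_add_sq
  refine Summable.of_nonneg_of_le (fun _ ↦ norm_nonneg _) (fun ρ ↦ ?_)
    (hS.mul_left (N * (4 * (‖z‖ + 1))))
  have hm : (0 : ℝ) ≤ riemannZetaZeroOrder (ρ : ℂ) := by
    exact_mod_cast riemannZetaZeroOrder_nonneg (ZetaZeros.riemannZetaNontrivialZeros.ne_one ρ.2)
  have hb := norm_weilMellin_suzukiPhiC_le ht ht' hz0 h1 h2
    (ZetaZeros.riemannZetaNontrivialZeros.re_lt_one ρ.2) (zeroParam_ne_zero ρ) (zeroParam_ne hz ρ)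
  have hq := inv_norm_mul_le hz ρ
  rw [norm_mul, Complex.norm_intCast, abs_of_nonneg hm]
  have hb' : ‖weilMellin (suzukiPhiC z t t') ρ‖ ≤ N * (4 * (‖z‖ + 1) / (1 + (ρ : ℂ).im ^ 2)) := by
    refine hb.trans ?_
    rw [div_eq_mul_one_div]
    exact mul_le_mul_of_nonneg_left hq hN0
  calc (riemannZetaZeroOrder (ρ : ℂ) : ℝ) * ‖weilMellin (suzukiPhiC z t t') ρ‖
      ≤ (riemannZetaZeroOrder (ρ : ℂ) : ℝ) * (N * (4 * (‖z‖ + 1) / (1 + (ρ : ℂ).im ^ 2))) :=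
        mul_le_mul_of_nonneg_left hb' hm
    _ = N * (4 * (‖z‖ + 1)) * ((riemannZetaZeroOrder (ρ : ℂ) : ℝ) / (1 + (ρ : ℂ).im ^ 2)) := by
        ring

/-- Summability of the `P_t` series with multiplicities, `Im z > 1`, `t > 0`.
[cite: Suzuki2025WeilHilbertSpace, eq. (3.2) (TeX l.776–781)] -/
theorem summable_screwTerm {z : ℂ} (hz : 1 < z.im) {t : ℝ} (ht : 0 < t) :
    Summable fun ρ : ZetaZeros.riemannZetaNontrivialZeros ↦
      (riemannZetaZeroOrder (ρ : ℂ) : ℂ) *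
        ((cexp (-(I * suzukiZeroParam ρ * t)) - 1) / suzukiZeroParam ρ *
          (1 / (z - suzukiZeroParam ρ))) := by
  have hS : Summable fun ρ : ZetaZeros.riemannZetaNontrivialZeros ↦
      (riemannZetaZeroOrder (ρ : ℂ) : ℝ) / (1 + (ρ : ℂ).im ^ 2) :=
    ZetaZeroSum.summable_zeroOrder_div_one_add_sq
  refine Summable.of_norm (Summable.of_nonneg_of_le (fun _ ↦ norm_nonneg _) (fun ρ ↦ ?_)
    (hS.mul_left ((Real.exp (t / 2) + 1) * (4 * (‖z‖ + 1)))))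
  have hm : (0 : ℝ) ≤ riemannZetaZeroOrder (ρ : ℂ) := by
    exact_mod_cast riemannZetaZeroOrder_nonneg (ZetaZeros.riemannZetaNontrivialZeros.ne_one ρ.2)
  have hb := norm_screwTerm_le (z := z) ht (ZetaZeros.riemannZetaNontrivialZeros.re_lt_one ρ.2)
    (ρ := (ρ : ℂ))
  have hq := inv_norm_mul_le hz ρ
  have hE : 0 ≤ Real.exp (t / 2) + 1 := by positivity
  rw [norm_mul, Complex.norm_intCast, abs_of_nonneg hm]
  have hb' : ‖(cexp (-(I * suzukiZeroParam ρ * t)) - 1) / suzukiZeroParam ρ *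
      (1 / (z - suzukiZeroParam ρ))‖ ≤ (Real.exp (t / 2) + 1) * (4 * (‖z‖ + 1) / (1 + (ρ : ℂ).im ^ 2)) := by
    refine hb.trans ?_
    rw [div_eq_mul_one_div]
    exact mul_le_mul_of_nonneg_left hq hE
  calc (riemannZetaZeroOrder (ρ : ℂ) : ℝ) * ‖(cexp (-(I * suzukiZeroParam ρ * t)) - 1) /
        suzukiZeroParam ρ * (1 / (z - suzukiZeroParam ρ))‖
      ≤ (riemannZetaZeroOrder (ρ : ℂ) : ℝ) *
          ((Real.exp (t / 2) + 1) * (4 * (‖z‖ + 1) / (1 + (ρ : ℂ).im ^ 2))) :=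
        mul_le_mul_of_nonneg_left hb' hm
    _ = (Real.exp (t / 2) + 1) * (4 * (‖z‖ + 1)) *
          ((riemannZetaZeroOrder (ρ : ℂ) : ℝ) / (1 + (ρ : ℂ).im ^ 2)) := by ring

/-- RH-FREE, PROVED — **the zero side of (3.3) for `g_{z;t,t'}` is `c_t P_t(z) − c_{t'} P_{t'}(z)`**
(`Im z > 1`, `t, t' > 0`; CJM TeX l.827–830: «the left-hand side of Weil's explicit formula for
`φ_{z,t}` gives `P_t(z)`»). [cite: Suzuki2025WeilHilbertSpace, proof of Prop. 3.1 (TeX l.822–830)] -/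
theorem tsum_zeroSide_eq {z : ℂ} (hz : 1 < z.im) {t t' : ℝ} (ht : 0 < t) (ht' : 0 < t') :
    ∑' ρ : ZetaZeros.riemannZetaNontrivialZeros,
        (riemannZetaZeroOrder (ρ : ℂ) : ℂ) * weilMellin (suzukiPhiC z t t') ρ =
      suzukiPhiCoeff z t * screwZeroExpansion t z - suzukiPhiCoeff z t' * screwZeroExpansion t' z := by
  have hz0 : z ≠ 0 := by rintro rfl; simp at hz; linarith
  have hzpos : 0 < z.im := zero_lt_one.trans hz
  have h1 := cexp_neg_I_mul_ne_one hzpos ht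
  have h2 := cexp_neg_I_mul_ne_one hzpos ht'
  have hterm : ∀ ρ : ZetaZeros.riemannZetaNontrivialZeros,
      (riemannZetaZeroOrder (ρ : ℂ) : ℂ) * weilMellin (suzukiPhiC z t t') ρ =
        suzukiPhiCoeff z t * ((riemannZetaZeroOrder (ρ : ℂ) : ℂ) *
            ((cexp (-(I * suzukiZeroParam ρ * t)) - 1) / suzukiZeroParam ρ *
              (1 / (z - suzukiZeroParam ρ)))) -
          suzukiPhiCoeff z t' * ((riemannZetaZeroOrder (ρ : ℂ) : ℂ) *
            ((cexp (-(I * suzukiZeroParam ρ * t')) - 1) / suzukiZeroParam ρ *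
              (1 / (z - suzukiZeroParam ρ)))) := by
    intro ρ
    rw [weilMellin_suzukiPhiC ht ht' hz0 h1 h2 (zeroParam_ne_zero ρ) (zeroParam_ne hz ρ)]
    ring
  rw [tsum_congr hterm, ((summable_screwTerm hz ht).mul_left _).tsum_sub
    ((summable_screwTerm hz ht').mul_left _), tsum_mul_left, tsum_mul_left]
  simp only [screwZeroExpansion, abs_of_pos ht, abs_of_pos ht']
  congr 1 <;> (congr 1; exact tsum_congr fun ρ ↦ by ring)

/-! ### The archimedean integrability input `hA` -/

/-- `‖ĝ(½ + iy)‖ ≤ ∫‖g‖` for a continuous compactly supported `g` (`|e^{iyx}| = 1`). [cite: Bombieri2000, Thm 2 (the Mellin transform on the critical line)] -/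
theorem norm_weilMellin_half_le_integral {g : ℝ → ℂ} (y : ℝ) :
    ‖weilMellin g (1 / 2 + y * I)‖ ≤ ∫ x : ℝ, ‖g x‖ := by
  unfold weilMellin
  refine (norm_integral_le_integral_norm _).trans (le_of_eq ?_)
  congr 1; ext x
  rw [norm_mul, Complex.norm_exp]
  have : ((1 / 2 + (y : ℂ) * I - 1 / 2) * (x : ℂ)).re = 0 := by
    simp [Complex.mul_re]
  rw [this, Real.exp_zero, mul_one]

/-- Decay on the critical line: for `Im z > 1`, `t, t' > 0` there is `D` with
`‖ĝ(½ + iy)‖ ≤ D/(1 + y²)` for all real `y` (closed form at `γ = −y`: `O(1/(|y|·|z + y|))`; near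
`y = 0` the `L¹` bound). [cite: Suzuki2025WeilHilbertSpace, proof of Prop. 3.1 (TeX l.822–826)] -/
theorem exists_norm_weilMellin_half_le {z : ℂ} (hz : 1 < z.im) {t t' : ℝ} (ht : 0 < t)
    (ht' : 0 < t') :
    ∃ D : ℝ, 0 ≤ D ∧ ∀ y : ℝ, ‖weilMellin (suzukiPhiC z t t') (1 / 2 + y * I)‖ ≤ D / (1 + y ^ 2) := by
  have hz0 : z ≠ 0 := by rintro rfl; simp at hz; linarith
  have hzpos : 0 < z.im := zero_lt_one.trans hz
  have h1 := cexp_neg_I_mul_ne_one hzpos ht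
  have h2 := cexp_neg_I_mul_ne_one hzpos ht'
  set N : ℝ := ‖suzukiPhiCoeff z t‖ * (Real.exp (t / 2) + 1) +
    ‖suzukiPhiCoeff z t'‖ * (Real.exp (t' / 2) + 1) with hN
  have hN0 : 0 ≤ N := by positivity
  set L : ℝ := ∫ x : ℝ, ‖suzukiPhiC z t t' x‖ with hL
  have hL0 : 0 ≤ L := integral_nonneg fun _ ↦ norm_nonneg _
  set Y : ℝ := 2 * ‖z‖ + 2 with hY
  refine ⟨max (4 * N) (L * (1 + Y ^ 2)), le_max_of_le_left (by positivity), fun y ↦ ?_⟩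
  have hγ : suzukiZeroParam (1 / 2 + y * I) = -(y : ℂ) := by
    simp [suzukiZeroParam]; ring_nf; rw [I_sq]; ring
  have hy2 : 0 < 1 + y ^ 2 := by positivity
  rcases le_or_gt Y |y| with hy | hy
  · -- large `|y|`: closed form
    have hy0 : y ≠ 0 := by
      intro h; rw [h, abs_zero] at hy; rw [hY] at hy; linarith [norm_nonneg z]
    have hγ0 : suzukiZeroParam (1 / 2 + y * I) ≠ 0 := by
      rw [hγ]; exact neg_ne_zero.2 (by exact_mod_cast hy0)
    have hγz : suzukiZeroParam (1 / 2 + y * I) ≠ z := by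
      rw [hγ]; intro h
      have := congrArg Complex.im h
      simp at this; linarith
    have hre : (1 / 2 + (y : ℂ) * I).re < 1 := by
      have : (1 / 2 + (y : ℂ) * I).re = 1 / 2 := by simp
      rw [this]; norm_num
    have hb := norm_weilMellin_suzukiPhiC_le ht ht' hz0 h1 h2 (ρ := 1 / 2 + y * I) hre hγ0 hγz
    rw [hγ, norm_neg, Complex.norm_real, Real.norm_eq_abs, sub_neg_eq_add] at hb
    -- `‖z + y‖ ≥ |y| − ‖z‖ ≥ |y|/2`
    have hzy : |y| / 2 ≤ ‖z + (y : ℂ)‖ := by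
      have h := norm_sub_norm_le (y : ℂ) (-z)
      rw [sub_neg_eq_add, add_comm, Complex.norm_real, norm_neg, Real.norm_eq_abs] at h
      rw [hY] at hy
      linarith
    have hyy : 0 < |y| := abs_pos.2 hy0
    have hden : |y| * (|y| / 2) ≤ |y| * ‖z + (y : ℂ)‖ := mul_le_mul_of_nonneg_left hzy hyy.le
    have hb' : ‖weilMellin (suzukiPhiC z t t') (1 / 2 + y * I)‖ ≤ N / (|y| * (|y| / 2)) :=
      hb.trans (div_le_div_of_nonneg_left hN0 (by positivity) hden)
    refine hb'.trans ?_
    have hsq : |y| * (|y| / 2) = y ^ 2 / 2 := by rw [← sq_abs y]; ring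
    rw [hsq, div_le_div_iff₀ (by positivity) hy2]
    have h1y : 1 ≤ y ^ 2 := by
      rw [← sq_abs y]; rw [hY] at hy; nlinarith [norm_nonneg z]
    have hmax : 4 * N ≤ max (4 * N) (L * (1 + Y ^ 2)) := le_max_left _ _
    have hy2' : 0 ≤ y ^ 2 / 2 := by positivity
    nlinarith [hmax, hy2', mul_le_mul_of_nonneg_right hmax hy2']
  · -- small `|y|`: the `L¹` bound
    have hb := norm_weilMellin_half_le_integral (g := suzukiPhiC z t t') y
    refine hb.trans ?_
    rw [le_div_iff₀ hy2]
    have hyY : y ^ 2 ≤ Y ^ 2 := by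
      rw [← sq_abs y]; exact pow_le_pow_left₀ (abs_nonneg y) hy.le 2
    calc L * (1 + y ^ 2) ≤ L * (1 + Y ^ 2) := by gcongr
      _ ≤ max (4 * N) (L * (1 + Y ^ 2)) := le_max_right _ _

open Literature.Analysis.SpecialFunctions.Complex in
/-- RH-FREE, PROVED — **the archimedean integrability input of (3.3) for `g_{z;t,t'}`**:
`y ↦ ĝ(½ + iy)·Re ψ(¼ + iy/2)` is integrable (`‖ĝ(½+iy)‖ = O((1+y²)⁻¹)` against
`‖ψ(¼ + iy/2)‖ ≤ C + log(1 + |y|) ≤ (C+2)(1 + |y|)^{1/2}`). [cite: Suzuki2025WeilHilbertSpace, eq. (3.3) (TeX l.804–820)] -/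
theorem integrable_weilMellin_mul_re_digamma {z : ℂ} (hz : 1 < z.im) {t t' : ℝ} (ht : 0 < t)
    (ht' : 0 < t') :
    Integrable fun u : ℝ ↦ weilMellin (suzukiPhiC z t t') (1 / 2 + u * I) *
      ((Complex.digamma (1 / 4 + u / 2 * I)).re : ℂ) := by
  have hzpos : 0 < z.im := zero_lt_one.trans hz
  have h1 := cexp_neg_I_mul_ne_one hzpos ht
  have h2 := cexp_neg_I_mul_ne_one hzpos ht'
  have hgc := continuous_suzukiPhiC z ht.le ht'.le
  have hgs := hasCompactSupport_suzukiPhiC z ht.le ht'.le h1 h2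
  obtain ⟨D, hD0, hD⟩ := exists_norm_weilMellin_half_le hz ht ht'
  obtain ⟨C, hC⟩ := exists_norm_digamma_vertical_le (a := 1 / 4) (by norm_num)
  -- continuity of the two factors
  have hG : Continuous fun u : ℝ ↦ weilMellin (suzukiPhiC z t t') (1 / 2 + u * I) := by
    have := continuous_weilMellin_vertical hgc hgs (1 / 2)
    refine this.congr fun u ↦ ?_
    push_cast; ring_nf
  have hF : Continuous fun u : ℝ ↦ ((Complex.digamma (1 / 4 + u / 2 * I)).re : ℂ) := by
    refine continuous_ofReal.comp (Complex.continuous_re.comp ?_)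
    refine continuousOn_digamma.comp_continuous (by fun_prop) fun u ↦ ?_
    simp
  -- the majorant `K (1 + |u|)^{-3/2}`
  set K : ℝ := 2 * D * (|C| + 2) with hK
  have hmaj : Integrable fun u : ℝ ↦ K * (1 + ‖u‖) ^ (-(3 / 2 : ℝ)) := by
    refine (integrable_one_add_norm ?_).const_mul K
    rw [Module.finrank_self]; norm_num
  refine hmaj.mono' (hG.mul hF).aestronglyMeasurable (Eventually.of_forall fun u ↦ ?_)
  set a : ℝ := 1 + |u| with ha_def
  have ha : 0 < a := by positivity
  have ha1 : 1 ≤ a := by rw [ha_def]; linarith [abs_nonneg u]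
  -- factor 1: `‖ĝ(½+iu)‖ ≤ 2D/a²`
  have hGu : ‖weilMellin (suzukiPhiC z t t') (1 / 2 + u * I)‖ ≤ 2 * D / a ^ 2 := by
    refine (hD u).trans ?_
    rw [div_le_div_iff₀ (by positivity) (by positivity)]
    have hsq : a ^ 2 ≤ 2 * (1 + u ^ 2) := by
      rw [ha_def, ← sq_abs u]; nlinarith [abs_nonneg u, sq_nonneg (|u| - 1)]
    nlinarith [hsq]
  -- factor 2: `‖Re ψ(¼ + iu/2)‖ ≤ (|C| + 2)√a`
  have hFu : ‖((Complex.digamma (1 / 4 + u / 2 * I)).re : ℂ)‖ ≤ (|C| + 2) * Real.sqrt a := by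
    have h1 : ‖((Complex.digamma (1 / 4 + u / 2 * I)).re : ℂ)‖ ≤
        ‖Complex.digamma (1 / 4 + u / 2 * I)‖ := by
      rw [Complex.norm_real, Real.norm_eq_abs]; exact Complex.abs_re_le_norm _
    have h2 := hC (u / 2)
    have h2' : ‖Complex.digamma (1 / 4 + u / 2 * I)‖ ≤ C + Real.log (1 + |u / 2|) := by
      convert h2 using 3; push_cast; ring
    have h3 : Real.log (1 + |u / 2|) ≤ Real.log a := by
      apply Real.log_le_log (by positivity)
      rw [ha_def, abs_div, abs_two]; linarith [abs_nonneg u]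
    have h4 : Real.log a ≤ 2 * Real.sqrt a := by
      have := Real.log_le_rpow_div ha.le one_half_pos
      rw [Real.sqrt_eq_rpow]; linarith
    have h5 : 1 ≤ Real.sqrt a := Real.one_le_sqrt.2 ha1
    calc ‖((Complex.digamma (1 / 4 + u / 2 * I)).re : ℂ)‖ ≤ C + Real.log (1 + |u / 2|) := h1.trans h2'
      _ ≤ |C| * 1 + 2 * Real.sqrt a := by linarith [le_abs_self C]
      _ ≤ |C| * Real.sqrt a + 2 * Real.sqrt a := by gcongr
      _ = (|C| + 2) * Real.sqrt a := by ring
  -- combine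
  have hfinal : Real.sqrt a / a ^ 2 = a ^ (-(3 / 2 : ℝ)) := by
    rw [Real.sqrt_eq_rpow, div_eq_mul_inv, ← Real.rpow_natCast a 2, ← Real.rpow_neg ha.le,
      ← Real.rpow_add ha]
    norm_num
  rw [norm_mul, Real.norm_eq_abs, ← ha_def, ← hfinal]
  calc ‖weilMellin (suzukiPhiC z t t') (1 / 2 + u * I)‖ *
        ‖((Complex.digamma (1 / 4 + u / 2 * I)).re : ℂ)‖
      ≤ (2 * D / a ^ 2) * ((|C| + 2) * Real.sqrt a) :=
        mul_le_mul hGu hFu (norm_nonneg _) (by positivity)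
    _ = K * (Real.sqrt a / a ^ 2) := by rw [hK]; ring


/-- RH-FREE, PROVED — **assembly of the explicit-formula half of CJM Prop 3.1, modulo the
archimedean term**: for `Im z > 1` and `0 < t ≤ t'`, IF the Bombieri archimedean term of
`g_{z;t,t'}` has the closed form `c_t·T(t) − c_{t'}·T(t')` with
`T(τ) = −(1/2iz)[ψ(¼ − iz/2) − ψ(¼)] − (1/2iz)e^{−τ/2}[Φ − Φ]` (terms 5–6 of `screwP`, TeX l.866–975)
THEN (the archimedean integrability input of the tree's (3.3) being
`integrable_weilMellin_mul_re_digamma`)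
`c_t(𝔓_t(z) − P_t(z)) = c_{t'}(𝔓_{t'}(z) − P_{t'}(z))` — the `t`-independence consumed by
`Suzuki2025_prop31_of_sub_eq_const_mul`.  Proof: (3.3) for the continuous compactly supported
Lipschitz `g` (`tsum_zeroSide_eq_bombieri`), `tsum_zeroSide_eq`, `weilPolarTerm_suzukiPhiC`,
`weilPrimeTerm_suzukiPhiC_of_le`; the `ζ'/ζ(½ − iz)` terms of `c_t𝔓_t` and `c_{t'}𝔓_{t'}` are both
`(iz)⁻¹ζ'/ζ(½ − iz)` (`suzukiPhiCoeff_mul`) and cancel. [cite: Suzuki2025WeilHilbertSpace, proof of Prop. 3.1 (TeX l.804–980)] -/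
theorem coeff_mul_sub_eq_of_arch {z : ℂ} (hz : 1 < z.im) {t t' : ℝ} (ht : 0 < t) (htt' : t ≤ t')
    (hArch : weilArchTermBombieri (suzukiPhiC z t t') =
      suzukiPhiCoeff z t * (-(1 / (2 * I * z) *
          (Complex.digamma (1 / 4 - I * z / 2) - Complex.digamma (1 / 4))) -
        1 / (2 * I * z) * ((Real.exp (-(t / 2)) : ℝ) : ℂ) * screwLerchBracket t z) -
      suzukiPhiCoeff z t' * (-(1 / (2 * I * z) *
          (Complex.digamma (1 / 4 - I * z / 2) - Complex.digamma (1 / 4))) -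
        1 / (2 * I * z) * ((Real.exp (-(t' / 2)) : ℝ) : ℂ) * screwLerchBracket t' z)) :
    suzukiPhiCoeff z t * (screwP t z - screwZeroExpansion t z) =
      suzukiPhiCoeff z t' * (screwP t' z - screwZeroExpansion t' z) := by
  have ht' : 0 < t' := ht.trans_le htt'
  have hzpos : 0 < z.im := zero_lt_one.trans hz
  have h1 := cexp_neg_I_mul_ne_one hzpos ht
  have h2 := cexp_neg_I_mul_ne_one hzpos ht'
  have hA := integrable_weilMellin_mul_re_digamma hz ht ht'
  obtain ⟨K, hK⟩ := lipschitzWith_suzukiPhiC z ht ht' h1 h2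
  have hEF := tsum_zeroSide_eq_bombieri (continuous_suzukiPhiC z ht.le ht'.le)
    (hasCompactSupport_suzukiPhiC z ht.le ht'.le h1 h2) hK (summable_norm_zeroSide hz ht ht') hA
  rw [tsum_zeroSide_eq hz ht ht', weilPolarTerm_suzukiPhiC hz ht ht',
    weilPrimeTerm_suzukiPhiC_of_le hzpos ht htt', hArch] at hEF
  have hc := suzukiPhiCoeff_mul z h1
  have hc' := suzukiPhiCoeff_mul z h2
  simp only [screwP, abs_of_pos ht, abs_of_pos ht']
  linear_combination (-1 : ℂ) * hEF +
    (deriv riemannZeta (1 / 2 - I * z) / riemannZeta (1 / 2 - I * z) / (I * z)) * hc -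
    (deriv riemannZeta (1 / 2 - I * z) / riemannZeta (1 / 2 - I * z) / (I * z)) * hc'

end ScrewExplicitHalf

end Literature.NumberTheory.LFunctions
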